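import Literature.Analysis.FluidPDE.SereginSverakPressureProofs
import Literature.Analysis.FluidPDE.Seregin2020CubicLowerBound
import Literature.Analysis.FluidPDE.RusinSverakBackwardRegularity
import Literature.Analysis.FluidPDE.CKNInnerCylinders

/-!
# Crux `SelfMixingDichotomy.SequentialTypeIExclusion` (stmt-NavierStokesRegularity-1424), line
  `registered`: STUB `stub_typeIWindowEpsilonRegularity` — ε-regularity under a Type-I bound

Lands `--supports stmt-NavierStokesRegularity-1424` the registered stub
`stub_typeIWindowEpsilonRegularity` of the lead's skeleton
`Cruxes/SequentialTypeIExclusion/Lines/birth.lean` (reshape r1): for every `M'` there is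
`ε = ε(M') > 0` such that for every classical Leray–Hopf solution (`ν = 1`) of Navier–Stokes on
`ℝ³ × [0, T)` from a rapidly decaying datum and every `x₀`, a centred cubic Type-I bound
`C(r; T, x₀) ≤ M'` for `0 < r < r₁` together with Type-I windows of depth `ε` at arbitrarily
small scales forces `u` to be bounded on some `(T − ρ², T) × B_ρ(x₀)`
(`C = Literature.Analysis.FluidPDE.cknC`, backward cylinders `Q_r(T, x₀)`).

Proof (Seregin's "ε-regularity under a Type-I bound", Seregin 2020 (2.9) pattern; every analytic
ingredient is proved in the tree):

0. constants first: the pressure-decay constant `c` (`seregin_sverak_pressure_decay_holds.ratio`),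
   a ratio `θ` with `c θ ≤ 1/2` (`exists_ratio_mul_le_half`), the solution-independent level
   `L = θ⁻² (1 + 2 c θ⁻² M')` and Seregin's `κ(L)`
   (`Seregin2020.exists_le_cknC_of_isBackwardSingularPoint`); `ε := κ / 2`;
1. gauge the pressure, `q = p − (p(·, 0) − p̃[u](0))`: `(u, q)` is a suitable weak solution on the
   slab `(0, T) × ℝ³` (`SereginSverak2002.isSuitableWeakSolutionOn_gauge_of_classical`) with
   `∬ |q|^{3/2} < ∞` (`SereginSverak2002.lintegral_slab_gauged_pressure_lt_top`), a square
   integrable weak gradient (`IsLerayHopfOn.exists_hasWeakSpatialGradientOn`) and bounded energy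
   (`SereginSverak2002.eEnergy_le`);
2. at the scale `r_I = min (r₁/2) √T` the cylinder `Q_{r_I}(T, x₀)` lies in the slab and
   `D(r_I) < ∞`;
3. the iterated pressure decay (`cknD_iterate_le_of_pressure_decay`) gives
   `D(θʲ r_I) ≤ 2^{-j} D(r_I) + 2 c θ⁻² M'`; from `J` on the first term is `≤ 1`, and by the
   intermediate-scale comparison (`cknD_le_mul_of_subset`) `D(ρ) ≤ L` for all `0 < ρ ≤ θᴶ r_I`;
4. a window `C(r) ≤ κ/2 < κ` below `θᴶ r_I` contradicts Seregin's lower bound `C ≥ κ` at a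
   backward singular point, so `u ∈ L^∞(Q_s(T, x₀))` for some `s > 0`;
5. `u` being continuous below `T`, the essential bound is a pointwise bound
   (`SereginSverak2002.norm_le_of_ae_restrict_of_continuousOn`).
-/

noncomputable section

-- the summit and its single problem share the name (D-0017 nested layout)
set_option linter.dupNamespace false

namespace Summit.NavierStokesRegularity.NavierStokesRegularity.Theorems.SequentialTypeIExclusion.Registered

open scoped ENNReal NNReal Topology
open Literature.Analysis.FluidPDE Set Filter MeasureTheory Function Metric

/-- The backward cylinder `Q_r(T, x₀)` with `r² ≤ T` lies in the slab `(0, T) × ℝ³`. -/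
private theorem parabolicCylinder_subset_slab {T r : ℝ} (hr : r ^ 2 ≤ T)
    (x₀ : EuclideanSpace ℝ (Fin 3)) :
    parabolicCylinder r ((T, x₀) : ℝ × EuclideanSpace ℝ (Fin 3)) ⊆
      Ioo 0 T ×ˢ (univ : Set (EuclideanSpace ℝ (Fin 3))) := by
  intro w hw
  simp only [mem_parabolicCylinder] at hw
  exact ⟨⟨by linarith [hw.1.1], hw.1.2⟩, mem_univ _⟩

/-- `D(r; z) < ∞` when `Q_r(z)` lies in a set over which `|q|^{3/2}` is integrable. -/
private theorem cknD_ne_top_of_subset {r : ℝ} (hr : 0 < r) {z : ℝ × EuclideanSpace ℝ (Fin 3)}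
    {S : Set (ℝ × EuclideanSpace ℝ (Fin 3))} {q : ℝ → EuclideanSpace ℝ (Fin 3) → ℝ}
    (hint : ∫⁻ w in S, ‖q w.1 w.2‖ₑ ^ (3 / 2 : ℝ) < ∞) (hS : parabolicCylinder r z ⊆ S) :
    cknD r z q ≠ ∞ := by
  rw [cknD]
  exact ENNReal.mul_ne_top
    (ENNReal.inv_ne_top.2 (pow_ne_zero _ (ENNReal.ofReal_pos.2 hr).ne'))
    (ne_top_of_le_ne_top hint.ne (lintegral_mono_set hS))

/-- `E(r; z) < ∞` when `Q_r(z)` lies in a set over which `|G|²` is integrable. -/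
private theorem cknE_ne_top_of_subset {r : ℝ} (hr : 0 < r) {z : ℝ × EuclideanSpace ℝ (Fin 3)}
    {S : Set (ℝ × EuclideanSpace ℝ (Fin 3))}
    {G : ℝ → EuclideanSpace ℝ (Fin 3) → EuclideanSpace ℝ (Fin 3) →L[ℝ] EuclideanSpace ℝ (Fin 3)}
    (hint : ∫⁻ w in S, ENNReal.ofReal (frobeniusNormSq (G w.1 w.2)) < ∞)
    (hS : parabolicCylinder r z ⊆ S) : cknE r z G ≠ ∞ := by
  rw [cknE]
  exact ENNReal.mul_ne_top (ENNReal.inv_ne_top.2 (ENNReal.ofReal_pos.2 hr).ne')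
    (ne_top_of_le_ne_top hint.ne (lintegral_mono_set hS))

/-- `A(r; T, x₀) < ∞` when the energy `∫ |u(t)|²` is bounded for `T - r² < t < T`. -/
private theorem cknAEss_ne_top_of_eEnergy_le {T r : ℝ} (hr : 0 < r)
    {x₀ : EuclideanSpace ℝ (Fin 3)}
    {u : ℝ → EuclideanSpace ℝ (Fin 3) → EuclideanSpace ℝ (Fin 3)} {K : ℝ≥0∞} (hK : K ≠ ∞)
    (hE : ∀ t ∈ Ioo (T - r ^ 2) T, eEnergy (u t) ≤ K) :
    cknAEss r ((T, x₀) : ℝ × EuclideanSpace ℝ (Fin 3)) u ≠ ∞ := by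
  refine ne_top_of_le_ne_top
    (ENNReal.mul_ne_top (ENNReal.inv_ne_top.2 (ENNReal.ofReal_pos.2 hr).ne') hK) ?_
  rw [cknAEss]
  refine essSup_le_of_ae_le _ ?_
  filter_upwards [ae_restrict_mem measurableSet_Ioo] with t ht
  gcongr
  exact (setLIntegral_le_lintegral _ _).trans (hE t ht)

/-- **STUB `stub_typeIWindowEpsilonRegularity` — ε-regularity under a Type-I bound** (Seregin
2014 notes Prop. 1.5 pattern in the cubic quantity; Seregin 2020, (2.9)). For every `M'` there
is `ε > 0` such that for every classical Leray–Hopf solution (`ν = 1`) of Navier–Stokes on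
`ℝ³ × [0, T)` from a rapidly decaying datum and every `x₀`: a centred cubic Type-I bound
`C(r; T, x₀) ≤ M'` for `0 < r < r₁` together with Type-I windows of depth `ε` at arbitrarily
small scales (`∀ r₀ > 0 ∃ r ∈ (0, r₀), C(r; T, x₀) ≤ ε`) implies that `u` is bounded on some
`(T − ρ², T) × B_ρ(x₀)`. -/
theorem stub_typeIWindowEpsilonRegularity :
    ∀ M' : ℝ, ∃ ε : ℝ, 0 < ε ∧ ∀ T : ℝ, 0 < T →
      ∀ (u : ℝ → EuclideanSpace ℝ (Fin 3) → EuclideanSpace ℝ (Fin 3))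
        (p : ℝ → EuclideanSpace ℝ (Fin 3) → ℝ),
        Literature.Analysis.FluidPDE.IsClassicalNSSolutionOn (Set.Ico 0 T) 1 0 u p →
        Literature.Analysis.FluidPDE.IsLerayHopfOn T 1 0 (u 0) u →
        Literature.Analysis.FluidPDE.HasRapidSpatialDecay (u 0) →
        ∀ x₀ : EuclideanSpace ℝ (Fin 3),
          (∃ r₁ : ℝ, 0 < r₁ ∧ ∀ r ∈ Set.Ioo 0 r₁,
            Literature.Analysis.FluidPDE.cknC r ((T, x₀) : ℝ × EuclideanSpace ℝ (Fin 3)) u ≤ ENNReal.ofReal M') →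
          (∀ r₀ : ℝ, 0 < r₀ → ∃ r ∈ Set.Ioo 0 r₀,
            Literature.Analysis.FluidPDE.cknC r ((T, x₀) : ℝ × EuclideanSpace ℝ (Fin 3)) u ≤ ENNReal.ofReal ε) →
          ∃ ρ : ℝ, 0 < ρ ∧ ∃ M : ℝ, ∀ t ∈ Set.Ioo (T - ρ ^ 2) T, ∀ x ∈ Metric.ball x₀ ρ, ‖u t x‖ ≤ M := by
  intro M'
  -- ### Step 0: the constants, independent of the solution
  obtain ⟨c, hc⟩ := seregin_sverak_pressure_decay_holds.ratio
  obtain ⟨θ, hθ, hθhalf, hcθ⟩ := exists_ratio_mul_le_half c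
  have hθ1 : θ ≤ 1 := hθhalf.trans (by norm_num)
  set Lenn : ℝ≥0∞ := ENNReal.ofReal (θ⁻¹) ^ 2 *
    (1 + 2 * (c * ENNReal.ofReal ((θ⁻¹) ^ 2) * ENNReal.ofReal M')) with hLenn
  have hLtop : Lenn ≠ ∞ := by
    refine ENNReal.mul_ne_top (ENNReal.pow_ne_top ENNReal.ofReal_ne_top)
      (ENNReal.add_ne_top.2 ⟨ENNReal.one_ne_top, ENNReal.mul_ne_top ENNReal.ofNat_ne_top ?_⟩)
    exact ENNReal.mul_ne_top (ENNReal.mul_ne_top ENNReal.coe_ne_top ENNReal.ofReal_ne_top)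
      ENNReal.ofReal_ne_top
  obtain ⟨κ, hκ, Hlow⟩ := Seregin2020.exists_le_cknC_of_isBackwardSingularPoint Lenn.toNNReal
  refine ⟨κ / 2, half_pos hκ, ?_⟩
  rintro T hT u p hcl hLH - x₀ ⟨r₁, hr₁, hTI⟩ hwin
  -- ### Step 1: the gauged suitable weak solution on the slab `(0, T) × ℝ³`
  set q : ℝ → EuclideanSpace ℝ (Fin 3) → ℝ :=
    fun t x => p t x - (p t 0 - normalisedPressure (u t) 0)
  have hsw : IsSuitableWeakSolutionOn
      (slab (EuclideanSpace ℝ (Fin 3)) (Ioo 0 T) isOpen_Ioo) 1 0 u q :=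
    SereginSverak2002.isSuitableWeakSolutionOn_gauge_of_classical one_pos hT hcl hLH _
      (coe_slab _ _).subset
  obtain ⟨G, hG, -, hGint, -⟩ := hLH.exists_hasWeakSpatialGradientOn
  have hqint : ∫⁻ w in Ioo 0 T ×ˢ (univ : Set (EuclideanSpace ℝ (Fin 3))),
      ‖q w.1 w.2‖ₑ ^ (3 / 2 : ℝ) < ∞ :=
    SereginSverak2002.lintegral_slab_gauged_pressure_lt_top one_pos hT hcl hLH
  -- ### Step 2: the initial scale `rI`, with `Q_{rI}(T, x₀)` inside the slab
  set rI : ℝ := min (r₁ / 2) (Real.sqrt T)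
  have hrI : 0 < rI := lt_min (half_pos hr₁) (Real.sqrt_pos.2 hT)
  have hrIr₁ : rI < r₁ := (min_le_left _ _).trans_lt (half_lt_self hr₁)
  have hrIT : rI ^ 2 ≤ T := by
    calc rI ^ 2 ≤ Real.sqrt T ^ 2 := pow_le_pow_left₀ hrI.le (min_le_right _ _) 2
      _ = T := Real.sq_sqrt hT.le
  have hsubI0 : parabolicCylinder rI ((T, x₀) : ℝ × EuclideanSpace ℝ (Fin 3)) ⊆
      Ioo 0 T ×ˢ (univ : Set (EuclideanSpace ℝ (Fin 3))) :=
    parabolicCylinder_subset_slab hrIT x₀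
  have hsubI : parabolicCylinder rI ((T, x₀) : ℝ × EuclideanSpace ℝ (Fin 3)) ⊆
      ((slab (EuclideanSpace ℝ (Fin 3)) (Ioo 0 T) isOpen_Ioo :
        TopologicalSpace.Opens (ℝ × EuclideanSpace ℝ (Fin 3))) :
          Set (ℝ × EuclideanSpace ℝ (Fin 3))) :=
    hsubI0.trans (coe_slab _ _).symm.subset
  have hDI : cknD rI ((T, x₀) : ℝ × EuclideanSpace ℝ (Fin 3)) q ≠ ∞ :=
    cknD_ne_top_of_subset hrI hqint hsubI0
  -- ### Step 3: `D ≤ Lenn` below the scale `r₂ = θ ^ J * rI`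
  have hCI : ∀ n : ℕ,
      cknC (θ ^ n * rI) ((T, x₀) : ℝ × EuclideanSpace ℝ (Fin 3)) u ≤ ENNReal.ofReal M' :=
    fun n => hTI _ ⟨by positivity,
      (mul_le_of_le_one_left hrI.le (pow_le_one₀ hθ.le hθ1)).trans_lt hrIr₁⟩
  have hDJ : ∀ n : ℕ, cknD (θ ^ n * rI) ((T, x₀) : ℝ × EuclideanSpace ℝ (Fin 3)) q ≤
      (2⁻¹ : ℝ≥0∞) ^ n * cknD rI ((T, x₀) : ℝ × EuclideanSpace ℝ (Fin 3)) q +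
        2 * (c * ENNReal.ofReal ((θ⁻¹) ^ 2) * ENNReal.ofReal M') := fun n =>
    cknD_iterate_le_of_pressure_decay hc hθ hθ1 hcθ hsw.distributional hrI hsubI
      fun j _ => hCI j
  obtain ⟨J, hJ⟩ : ∃ J : ℕ,
      (2⁻¹ : ℝ≥0∞) ^ J * cknD rI ((T, x₀) : ℝ × EuclideanSpace ℝ (Fin 3)) q ≤ 1 := by
    obtain ⟨n, hn⟩ := ENNReal.exists_inv_two_pow_lt (ENNReal.inv_ne_zero.2 hDI)
    exact ⟨n, ENNReal.le_inv_iff_mul_le.1 hn.le⟩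
  obtain ⟨r₂, hr₂_def⟩ : ∃ r₂ : ℝ, r₂ = θ ^ J * rI := ⟨_, rfl⟩
  have hr₂ : 0 < r₂ := by rw [hr₂_def]; positivity
  have hr₂I : r₂ ≤ rI := by
    rw [hr₂_def]; exact mul_le_of_le_one_left hrI.le (pow_le_one₀ hθ.le hθ1)
  have hr₂T : r₂ ^ 2 ≤ T := (pow_le_pow_left₀ hr₂.le hr₂I 2).trans hrIT
  have hsub₂0 : parabolicCylinder r₂ ((T, x₀) : ℝ × EuclideanSpace ℝ (Fin 3)) ⊆
      Ioo 0 T ×ˢ (univ : Set (EuclideanSpace ℝ (Fin 3))) :=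
    parabolicCylinder_subset_slab hr₂T x₀
  have hsub₂ : parabolicCylinder r₂ ((T, x₀) : ℝ × EuclideanSpace ℝ (Fin 3)) ⊆
      ((slab (EuclideanSpace ℝ (Fin 3)) (Ioo 0 T) isOpen_Ioo :
        TopologicalSpace.Opens (ℝ × EuclideanSpace ℝ (Fin 3))) :
          Set (ℝ × EuclideanSpace ℝ (Fin 3))) :=
    hsub₂0.trans (coe_slab _ _).symm.subset
  have hDr : ∀ ρ ∈ Ioc (0 : ℝ) r₂,
      cknD ρ ((T, x₀) : ℝ × EuclideanSpace ℝ (Fin 3)) q ≤ ((Lenn.toNNReal : ℝ≥0) : ℝ≥0∞) := by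
    intro ρ hρ
    rw [ENNReal.coe_toNNReal hLtop]
    obtain ⟨j, hj1, hj2⟩ := exists_nat_pow_near_of_lt_one (div_pos hρ.1 hr₂)
      ((div_le_one hr₂).2 hρ.2) hθ (by linarith)
    have hle : ρ ≤ θ ^ j * r₂ := by rwa [div_le_iff₀ hr₂] at hj2
    have hlt : θ ^ j * r₂ < θ⁻¹ * ρ := by
      rw [lt_div_iff₀ hr₂] at hj1
      have e1 : θ ^ j * r₂ = θ⁻¹ * (θ ^ (j + 1) * r₂) := by
        rw [pow_succ]; field_simp
      rw [e1]
      exact mul_lt_mul_of_pos_left hj1 (inv_pos.2 hθ)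
    have hsub : parabolicCylinder ρ ((T, x₀) : ℝ × EuclideanSpace ℝ (Fin 3)) ⊆
        parabolicCylinder (θ ^ j * r₂) ((T, x₀) : ℝ × EuclideanSpace ℝ (Fin 3)) :=
      parabolicCylinder_mono hρ.1.le hle _
    have hjJ : θ ^ j * r₂ = θ ^ (j + J) * rI := by rw [hr₂_def, pow_add, mul_assoc]
    calc cknD ρ ((T, x₀) : ℝ × EuclideanSpace ℝ (Fin 3)) q
        ≤ ENNReal.ofReal (θ ^ j * r₂ / ρ) ^ 2 *
            cknD (θ ^ j * r₂) ((T, x₀) : ℝ × EuclideanSpace ℝ (Fin 3)) q :=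
          cknD_le_mul_of_subset (by positivity) hρ.1 hsub q
      _ ≤ ENNReal.ofReal (θ⁻¹) ^ 2 *
            ((2⁻¹ : ℝ≥0∞) ^ (j + J) * cknD rI ((T, x₀) : ℝ × EuclideanSpace ℝ (Fin 3)) q +
              2 * (c * ENNReal.ofReal ((θ⁻¹) ^ 2) * ENNReal.ofReal M')) := by
          gcongr
          · exact (div_le_iff₀ hρ.1).2 hlt.le
          · rw [hjJ]; exact hDJ (j + J)
      _ ≤ Lenn := by
          rw [hLenn]
          gcongr
          calc (2⁻¹ : ℝ≥0∞) ^ (j + J) * cknD rI ((T, x₀) : ℝ × EuclideanSpace ℝ (Fin 3)) q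
              = 2⁻¹ ^ j * (2⁻¹ ^ J * cknD rI ((T, x₀) : ℝ × EuclideanSpace ℝ (Fin 3)) q) := by
                rw [pow_add, mul_assoc]
            _ ≤ 1 * 1 :=
                mul_le_mul' (pow_le_one₀ zero_le (ENNReal.inv_le_one.2 one_le_two)) hJ
            _ = 1 := one_mul _
  -- ### Step 4: a window of depth `κ / 2` below `r₂` excludes a backward singular point
  have hAI : cknAEss r₂ ((T, x₀) : ℝ × EuclideanSpace ℝ (Fin 3)) u ≠ ∞ := by
    refine cknAEss_ne_top_of_eEnergy_le hr₂
      (K := ENNReal.ofReal (2 * VectorCalculus.kineticEnergy (u 0))) ENNReal.ofReal_ne_top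
      fun t ht => ?_
    exact SereginSverak2002.eEnergy_le zero_le_one hLH ⟨by linarith [ht.1], ht.2.le⟩
  have hEI : cknE r₂ ((T, x₀) : ℝ × EuclideanSpace ℝ (Fin 3)) G ≠ ∞ :=
    cknE_ne_top_of_subset hr₂ hGint hsub₂0
  obtain ⟨r, hr, hCr⟩ := hwin r₂ hr₂
  have hns : ¬ IsBackwardSingularPoint u ((T, x₀) : ℝ × EuclideanSpace ℝ (Fin 3)) := by
    intro hsing
    have hle := Hlow _ u q G hsw hG _ r₂ hr₂ hsub₂ hAI hEI hDr hsing r ⟨hr.1, hr.2.le⟩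
    have hlt : ENNReal.ofReal (κ / 2) < ENNReal.ofReal κ :=
      (ENNReal.ofReal_lt_ofReal_iff hκ).2 (half_lt_self hκ)
    exact lt_irrefl _ ((hle.trans hCr).trans_lt hlt)
  -- ### Step 5: essential boundedness on a cylinder below `T` is a pointwise bound
  obtain ⟨s, hs, hfin⟩ : ∃ s : ℝ, 0 < s ∧ eLpNorm (uncurry u) ∞
      (volume.restrict (parabolicCylinder s ((T, x₀) : ℝ × EuclideanSpace ℝ (Fin 3)))) ≠ ∞ := by
    by_contra h
    exact hns fun s hs => of_not_not fun hne => h ⟨s, hs, hne⟩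
  set ρ : ℝ := min s r₂
  have hρ : 0 < ρ := lt_min hs hr₂
  have hρT : ρ ^ 2 ≤ T := (pow_le_pow_left₀ hρ.le (min_le_right _ _) 2).trans hr₂T
  have hVs : parabolicCylinder ρ ((T, x₀) : ℝ × EuclideanSpace ℝ (Fin 3)) ⊆
      parabolicCylinder s ((T, x₀) : ℝ × EuclideanSpace ℝ (Fin 3)) :=
    parabolicCylinder_mono hρ.le (min_le_left _ _) _
  have hfinV : eLpNorm (uncurry u) ∞
      (volume.restrict (parabolicCylinder ρ ((T, x₀) : ℝ × EuclideanSpace ℝ (Fin 3)))) ≠ ∞ :=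
    ne_top_of_le_ne_top hfin (eLpNorm_mono_measure _ (Measure.restrict_mono_set _ hVs))
  have hae : ∀ᵐ w ∂(volume.restrict (parabolicCylinder ρ ((T, x₀) : ℝ × EuclideanSpace ℝ (Fin 3)))),
      ‖uncurry u w‖ ≤ (eLpNorm (uncurry u) ∞ (volume.restrict
        (parabolicCylinder ρ ((T, x₀) : ℝ × EuclideanSpace ℝ (Fin 3))))).toReal := by
    have h1 := ae_le_eLpNormEssSup (μ := volume.restrict
      (parabolicCylinder ρ ((T, x₀) : ℝ × EuclideanSpace ℝ (Fin 3)))) (f := uncurry u)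
    rw [eLpNorm_exponent_top] at hfinV ⊢
    filter_upwards [h1] with w hw
    exact (toReal_enorm (uncurry u w)) ▸ ENNReal.toReal_mono hfinV hw
  have hcont : ContinuousOn (uncurry u)
      (parabolicCylinder ρ ((T, x₀) : ℝ × EuclideanSpace ℝ (Fin 3))) :=
    (SereginSverak2002.continuousOn_uncurry hcl).mono
      ((parabolicCylinder_subset_slab hρT x₀).trans (prod_mono Ioo_subset_Ico_self Subset.rfl))
  have hall := SereginSverak2002.norm_le_of_ae_restrict_of_continuousOn
    (isOpen_parabolicCylinder ρ _) hcont hae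
  refine ⟨ρ, hρ, _, fun t ht x hx => hall (t, x) ?_⟩
  rw [mem_parabolicCylinder]
  exact ⟨⟨ht.1, ht.2⟩, mem_ball.1 hx⟩

end Summit.NavierStokesRegularity.NavierStokesRegularity.Theorems.SequentialTypeIExclusion.Registered

end
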